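import Mathlib
import Literature.Analysis.Convex.MatrixStarAlgebraPSD
import HarnessLib

/-!
# The regular `*`-representation of a matrix `*`-algebra

[dKDP] E. de Klerk, C. Dobre, D. V. Pasechnik, *Numerical block diagonalization of matrix
`*`-algebras with application to semidefinite programming*, Math. Program. 129 (2011) 91–111,
doi:10.1007/s10107-011-0461-3 (bib `DeklerkDobrePasechnik2011`), §5 "The regular
`*`-representation of `𝒜`" (held text `paper:doi-10-1007-s10107-011-0461-3`, chunk 9: the
normalised basis `Dₖ`, the multiplication parameters, Thm 2 and eq. (7)), restating
[dKPS] E. de Klerk, D. V. Pasechnik, A. Schrijver, *Reduction of symmetric semidefinite programs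
using the regular `*`-representation*, Math. Program. B 109 (2007) 613–624
(bib `DeklerkPasechnikSchrijver2006`; not held — acquisition request acq-10218), and
[dK10] E. de Klerk, *Exploiting special structure in semidefinite programming*, EJOR 201 (2010),
§4.1 Thm 4 (bib `Klerk2010`).

> [dKDP, §5] Assume now that `𝒜` has an orthogonal basis of real matrices `B₁, …, B_d`.  We
> normalize this basis with respect to the Frobenius norm, `Dᵢ := Bᵢ/√tr(Bᵢᵀ Bᵢ)`, and define
> multiplication parameters `γᵏᵢⱼ` via `Dᵢ Dⱼ = Σₖ γᵏᵢⱼ Dₖ`, and subsequently define the `d × d`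
> matrices `Lₖ`, `(Lₖ)ᵢⱼ := γⁱₖⱼ`.  The matrices `Lₖ` form a basis of a faithful (i.e. isomorphic)
> representation of `𝒜`, say `𝒜_reg`, that is also a matrix `*`-algebra, called the regular
> `*`-representation of `𝒜`.
> **Theorem 2** (cf. [dKPS]). The bijective linear mapping `φ : 𝒜 → 𝒜_reg`, `φ(Dₖ) = Lₖ`,
> defines a `*`-isomorphism from `𝒜` to `𝒜_reg`.  Thus, `φ` is an algebra isomorphism with the
> additional property `φ(A*) = φ(A)*` for all `A ∈ 𝒜`.
> Since `φ` is a homomorphism, `A` and `φ(A)` have the same eigenvalues (up to multiplicities)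
> for all `A ∈ 𝒜`.  As a consequence, one has `Σₖ xₖ Dₖ ⪰ 0 ⟺ Σₖ xₖ Lₖ ⪰ 0`.

## What is here

For a matrix `*`-algebra `𝒜 ⊆ 𝕜^{n×n}` (`𝕜 = ℝ` or `ℂ`, a `StarSubalgebra`) and a basis
`b : Basis ι 𝕜 𝒜` which is ORTHONORMAL for the trace (Frobenius) form
`⟨Y, Z⟩ = tr(Yᴴ Z)` (`IsTraceOrthonormal b`, the normalised basis `D₁, …, D_d` of [dKDP]):

* `repr_eq_trace` — coordinates are trace pairings: `(b.repr Y)ᵢ = tr(Dᵢᴴ Y)`;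
* `leftMulMatrix_apply_eq_trace` — the regular representation `L(X) := ` the matrix of
  `Y ↦ X Y` in the basis `b` (Mathlib's `Algebra.leftMulMatrix b`) has entries
  `L(X)ᵢⱼ = tr(Dᵢᴴ X Dⱼ)`; for `X = Dₖ` these are the multiplication parameters `γⁱₖⱼ`
  (`leftMulMatrix_basis_eq_mulParam`, `basis_mul_basis_eq_sum`: `Dₖ Dⱼ = Σᵢ (Lₖ)ᵢⱼ Dᵢ`);
* `leftMulMatrix_star` — **the `*`-property of [dKDP, Thm 2]**: `L(Xᴴ) = L(X)ᴴ`
  (this is where orthonormality w.r.t. the TRACE form is used);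
* `regularRep b hb : 𝒜 →⋆ₐ[𝕜] Matrix ι ι 𝕜` — the regular `*`-representation as a unital
  `*`-algebra homomorphism, injective (`regularRep_injective`, "faithful");
* `posSemidef_regularRep_iff` — **[dKDP, (7)] / [dK10, Thm 4 ff.]**: `L(X) ⪰ 0 ↔ X ⪰ 0`, and
  in coordinates `Σₖ xₖ Lₖ ⪰ 0 ↔ Σₖ xₖ Dₖ ⪰ 0` (`posSemidef_sum_smul_regularRep_iff`) — the
  `n × n` LMI of an invariant SDP is replaced by a `d × d` one, `d = dim 𝒜`
  (via `Literature.Analysis.Convex.MatrixStarAlgebra.posSemidef_map_iff`);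
* `hasEigenvector_iff_regularRep` — **[dKDP, after Thm 2]** "`A` and `φ(A)` have the same
  eigenvalues": `μ` is an eigenvalue of `X ∈ 𝒜` iff it is an eigenvalue of `L(X)` (the
  multiplicities differ in general).  (*Proof of `→`:* if `X - μ` were not a zero divisor in
  the finite-dimensional algebra `𝒜`, left multiplication by it would be surjective on `𝒜`,
  giving a right inverse in `𝒜 ⊆ 𝕜^{n×n}`, hence `X - μ` invertible.)

* `exists_isTraceOrthonormal` — the standing assumption of [dKDP, §5] ("assume now that `𝒜`
  has an orthogonal basis …, normalised with respect to the Frobenius norm") always holds over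
  `𝕜 = ℝ, ℂ`: vectorise `𝕜^{n×n}` into the Euclidean space `𝕜^{n·n}` (`vecE`, `inner_vecE`:
  `⟪vec X, vec Y⟫ = tr(Xᴴ Y)`) and pull back an orthonormal basis of the image of `𝒜`; hence
  `exists_faithful_starAlgHom_posSemidef_iff`: every matrix `*`-algebra has a faithful unital
  `*`-representation `φ : 𝒜 →⋆ₐ[𝕜] 𝕜^{d×d}`, `d = dim 𝒜`, with `φ X ⪰ 0 ↔ X ⪰ 0`.

All statements are theorems; standard axioms only.
-/

open scoped Matrix MatrixOrder ComplexOrder InnerProductSpace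

namespace Literature.Analysis.Convex.RegularStarRepresentation

open Literature.Analysis.Convex.MatrixStarAlgebra

variable {𝕜 : Type*} [RCLike 𝕜]
variable {n : Type*} [Fintype n] [DecidableEq n]
variable {ι : Type*} [Fintype ι] [DecidableEq ι]

/-- A basis `D₁, …, D_d` of the matrix `*`-algebra `𝒜` is **trace-orthonormal** if
`tr(Dᵢᴴ Dⱼ) = δᵢⱼ` — the Frobenius-normalised orthogonal basis of [dKDP, §5]
("we normalize this basis with respect to the Frobenius norm").
[cite: DeklerkDobrePasechnik2011, §5 (normalised basis D_k)] -/
def IsTraceOrthonormal (𝒜 : StarSubalgebra 𝕜 (Matrix n n 𝕜)) (b : Module.Basis ι 𝕜 𝒜) : Prop :=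
  ∀ i j, (((b i : 𝒜) : Matrix n n 𝕜)ᴴ * ((b j : 𝒜) : Matrix n n 𝕜)).trace =
    if i = j then (1 : 𝕜) else 0

variable {𝒜 : StarSubalgebra 𝕜 (Matrix n n 𝕜)} {b : Module.Basis ι 𝕜 𝒜}

/-- For a trace-orthonormal basis the coordinates of `Y ∈ 𝒜` are the trace pairings
`(b.repr Y)ᵢ = tr(Dᵢᴴ Y)` (expand `Y = Σⱼ cⱼ Dⱼ` and use `tr(Dᵢᴴ Dⱼ) = δᵢⱼ`).
[cite: DeklerkDobrePasechnik2011, §5 (coordinates in the basis D_k)] -/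
theorem repr_eq_trace (hb : IsTraceOrthonormal 𝒜 b) (Y : 𝒜) (i : ι) :
    b.repr Y i = (((b i : 𝒜) : Matrix n n 𝕜)ᴴ * (Y : Matrix n n 𝕜)).trace := by
  have hY : (Y : Matrix n n 𝕜) = ∑ j, b.repr Y j • ((b j : 𝒜) : Matrix n n 𝕜) := by
    conv_lhs => rw [← b.sum_repr Y]
    rw [AddSubmonoidClass.coe_finsetSum]
    simp
  rw [hY, Finset.mul_sum, Matrix.trace_sum]
  simp_rw [Matrix.mul_smul, Matrix.trace_smul, hb i, smul_eq_mul, mul_ite, mul_one, mul_zero]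
  rw [Finset.sum_ite_eq Finset.univ i]
  simp

/-- Entries of the regular representation: the matrix of `Y ↦ X Y` in a trace-orthonormal
basis has `(i, j)` entry `tr(Dᵢᴴ X Dⱼ)`.
[cite: DeklerkDobrePasechnik2011, §5 (the matrices L_k)] -/
theorem leftMulMatrix_apply_eq_trace (hb : IsTraceOrthonormal 𝒜 b) (X : 𝒜) (i j : ι) :
    Algebra.leftMulMatrix b X i j =
      (((b i : 𝒜) : Matrix n n 𝕜)ᴴ * ((X : Matrix n n 𝕜) * ((b j : 𝒜) : Matrix n n 𝕜))).trace := by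
  rw [Algebra.leftMulMatrix_eq_repr_mul, repr_eq_trace hb]
  rfl

/-- The multiplication parameters: `(L(Dₖ))ᵢⱼ = γⁱₖⱼ := ` the `Dᵢ`-coordinate of `Dₖ Dⱼ`
(the defining formula `Dₖ Dⱼ = Σᵢ γⁱₖⱼ Dᵢ`, `(Lₖ)ᵢⱼ = γⁱₖⱼ` of [dKDP, §5]).
[cite: DeklerkDobrePasechnik2011, §5 (multiplication parameters γ, matrices L_k)] -/
theorem leftMulMatrix_basis_eq_mulParam (k i j : ι) :
    Algebra.leftMulMatrix b (b k) i j = b.repr (b k * b j) i :=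
  Algebra.leftMulMatrix_eq_repr_mul b (b k) i j

/-- The defining relation of the multiplication parameters, `Dₖ Dⱼ = Σᵢ γⁱₖⱼ Dᵢ` with
`γⁱₖⱼ = (Lₖ)ᵢⱼ = L(Dₖ)ᵢⱼ`: the `j`-th column of `Lₖ` lists the coordinates of `Dₖ Dⱼ`.
[cite: DeklerkDobrePasechnik2011, §5 (D_i D_j = Σ_k γ^k_ij D_k)] -/
theorem basis_mul_basis_eq_sum (k j : ι) :
    b k * b j = ∑ i, Algebra.leftMulMatrix b (b k) i j • b i := by
  conv_lhs => rw [← b.sum_repr (b k * b j)]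
  simp_rw [leftMulMatrix_basis_eq_mulParam]

/-- **The `*`-property [dKDP, Thm 2]:** in a trace-orthonormal basis the regular representation
commutes with the involution, `L(Xᴴ) = L(X)ᴴ`, because
`tr(Dᵢᴴ Xᴴ Dⱼ) = conj tr(Dⱼᴴ X Dᵢ)`.
[cite: DeklerkDobrePasechnik2011, §5 Thm 2 (φ(A*) = φ(A)*)] -/
theorem leftMulMatrix_star (hb : IsTraceOrthonormal 𝒜 b) (X : 𝒜) :
    Algebra.leftMulMatrix b (star X) = (Algebra.leftMulMatrix b X)ᴴ := by
  ext i j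
  rw [Matrix.conjTranspose_apply, leftMulMatrix_apply_eq_trace hb,
    leftMulMatrix_apply_eq_trace hb, ← Matrix.trace_conjTranspose]
  congr 1
  have hs : ((star X : 𝒜) : Matrix n n 𝕜) = ((X : 𝒜) : Matrix n n 𝕜)ᴴ := rfl
  rw [hs, Matrix.conjTranspose_mul, Matrix.conjTranspose_mul, Matrix.conjTranspose_conjTranspose,
    Matrix.mul_assoc]

/-- **The regular `*`-representation** `φ : 𝒜 →⋆ₐ[𝕜] 𝕜^{d×d}`, `X ↦ L(X)` = the matrix of left
multiplication by `X` on `𝒜` in the trace-orthonormal basis `b` — Mathlib's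
`Algebra.leftMulMatrix b` upgraded to a unital `*`-algebra homomorphism by `leftMulMatrix_star`.
[cite: DeklerkDobrePasechnik2011, §5 Thm 2 (the *-isomorphism φ : 𝒜 → 𝒜_reg; cf. DeklerkPasechnikSchrijver2006)] -/
noncomputable def regularRep (b : Module.Basis ι 𝕜 𝒜) (hb : IsTraceOrthonormal 𝒜 b) :
    𝒜 →⋆ₐ[𝕜] Matrix ι ι 𝕜 :=
  { Algebra.leftMulMatrix b with
    map_star' := fun X => by
      change Algebra.leftMulMatrix b (star X) = (Algebra.leftMulMatrix b X)ᴴ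
      exact leftMulMatrix_star hb X }

/-- As a matrix, `regularRep b hb X` is Mathlib's `Algebra.leftMulMatrix b X` (the matrix of
`Y ↦ X Y` in the basis `b`). [cite: DeklerkDobrePasechnik2011, §5 Thm 2 (φ(D_k) = L_k)] -/
@[simp]
theorem regularRep_apply (hb : IsTraceOrthonormal 𝒜 b) (X : 𝒜) :
    regularRep b hb X = Algebra.leftMulMatrix b X := rfl

/-- The regular `*`-representation is faithful ("a faithful (i.e. isomorphic) representation of
`𝒜`", [dKDP, §5]): `1 ∈ 𝒜`, so `L(X) = 0` forces `X = X·1 = 0`.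
[cite: DeklerkDobrePasechnik2011, §5 Thm 2 (φ bijective onto 𝒜_reg, 'faithful')] -/
theorem regularRep_injective (hb : IsTraceOrthonormal 𝒜 b) :
    Function.Injective (regularRep b hb) :=
  fun _ _ h => Algebra.leftMulMatrix_injective b h

/-- **PSD transfer [dKDP, (7)] / [dK10, Thm 4 and the display after it]:** for `X ∈ 𝒜`,
`L(X) ⪰ 0 ↔ X ⪰ 0` — an injective unital `*`-homomorphism preserves and reflects positive
semidefiniteness (`MatrixStarAlgebra.posSemidef_map_iff`).
[cite: DeklerkDobrePasechnik2011, §5 eq. (7); Klerk2010 §4.1 Thm 4 and sequel] -/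
theorem posSemidef_regularRep_iff (hb : IsTraceOrthonormal 𝒜 b) (X : 𝒜) :
    (regularRep b hb X).PosSemidef ↔ (X : Matrix n n 𝕜).PosSemidef :=
  posSemidef_map_iff 𝒜 (regularRep b hb) (regularRep_injective hb) X

/-- The same in coordinates, literally as printed: `Σₖ xₖ Lₖ ⪰ 0 ⟺ Σₖ xₖ Dₖ ⪰ 0`, where
`Lₖ = L(Dₖ)` — the `n × n` linear matrix inequality over `𝒜` becomes a `d × d` one.
[cite: DeklerkDobrePasechnik2011, §5 eq. (7) (Σ x_k D_k ⪰ 0 ⟺ Σ x_k L_k ⪰ 0)] -/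
theorem posSemidef_sum_smul_regularRep_iff (hb : IsTraceOrthonormal 𝒜 b) (x : ι → 𝕜) :
    (∑ k, x k • regularRep b hb (b k)).PosSemidef ↔
      (∑ k, x k • ((b k : 𝒜) : Matrix n n 𝕜)).PosSemidef := by
  have h1 : ∑ k, x k • regularRep b hb (b k) = regularRep b hb (∑ k, x k • b k) := by
    simp [map_sum, map_smul]
  have h2 : ∑ k, x k • ((b k : 𝒜) : Matrix n n 𝕜) = (((∑ k, x k • b k : 𝒜)) : Matrix n n 𝕜) := by
    rw [AddSubmonoidClass.coe_finsetSum]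
    simp
  rw [h1, h2]
  exact posSemidef_regularRep_iff hb _

omit [DecidableEq ι] in
/-- In a finite-dimensional matrix algebra containing `1`, an element which is not a left zero
divisor IN `𝒜` is invertible as a matrix: left multiplication is then injective on `𝒜`, hence
surjective, so `T C = 1` for some `C ∈ 𝒜`. [folklore] -/
private theorem exists_mul_eq_zero_of_mulVec_eq_zero (b : Module.Basis ι 𝕜 𝒜) (T : 𝒜) {v : n → 𝕜}
    (hv : v ≠ 0) (hTv : (T : Matrix n n 𝕜) *ᵥ v = 0) : ∃ C : 𝒜, C ≠ 0 ∧ T * C = 0 := by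
  haveI : FiniteDimensional 𝕜 𝒜 := Module.Finite.of_basis b
  by_contra hne
  push Not at hne
  have hinj : Function.Injective (LinearMap.mulLeft 𝕜 T : 𝒜 →ₗ[𝕜] 𝒜) := by
    rw [injective_iff_map_eq_zero]
    intro C hC
    by_contra hC0
    exact hne C hC0 (by simpa using hC)
  have hsurj := LinearMap.injective_iff_surjective.mp hinj
  obtain ⟨C, hC⟩ := hsurj 1
  have hTC : (T : Matrix n n 𝕜) * (C : Matrix n n 𝕜) = 1 := by
    have := congrArg (fun Z : 𝒜 => (Z : Matrix n n 𝕜)) hC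
    simpa using this
  have hCT : (C : Matrix n n 𝕜) * (T : Matrix n n 𝕜) = 1 := mul_eq_one_comm.mp hTC
  apply hv
  calc v = ((C : Matrix n n 𝕜) * (T : Matrix n n 𝕜)) *ᵥ v := by rw [hCT, Matrix.one_mulVec]
    _ = 0 := by rw [← Matrix.mulVec_mulVec, hTv, Matrix.mulVec_zero]

/-- **Same eigenvalues [dKDP, after Thm 2]:** "since `φ` is a homomorphism, `A` and `φ(A)` have
the same eigenvalues (up to multiplicities)": `μ` is an eigenvalue of `X ∈ 𝒜` (acting on `𝕜ⁿ`)
iff `μ` is an eigenvalue of `L(X)` (acting on `𝕜ᵈ`).  (`←`: a `μ`-eigenvector `c` of `L(X)` is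
the coordinate vector of `C ∈ 𝒜`, `C ≠ 0`, with `X C = μ C`, and any non-zero column of `C` is a
`μ`-eigenvector of `X`; `→`: `X - μ·1 ∈ 𝒜` is singular, hence — `𝒜` being finite-dimensional and
unital — a left zero divisor inside `𝒜`.)
[cite: DeklerkDobrePasechnik2011, §5 sequel of Thm 2 (same eigenvalues)] -/
theorem hasEigenvector_iff_regularRep (hb : IsTraceOrthonormal 𝒜 b) (X : 𝒜) (μ : 𝕜) :
    (∃ v : n → 𝕜, v ≠ 0 ∧ (X : Matrix n n 𝕜) *ᵥ v = μ • v) ↔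
      ∃ c : ι → 𝕜, c ≠ 0 ∧ regularRep b hb X *ᵥ c = μ • c := by
  constructor
  · rintro ⟨v, hv, hXv⟩
    -- `T := X - μ•1 ∈ 𝒜` kills `v`, so it is a left zero divisor in `𝒜`
    set T : 𝒜 := X - algebraMap 𝕜 𝒜 μ with hT
    have hTv : (T : Matrix n n 𝕜) *ᵥ v = 0 := by
      have hTcoe : (T : Matrix n n 𝕜) = (X : Matrix n n 𝕜) - algebraMap 𝕜 (Matrix n n 𝕜) μ := by
        rw [hT]
        rfl
      rw [hTcoe, Matrix.sub_mulVec, hXv, Matrix.algebraMap_eq_diagonal, Pi.algebraMap_def,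
        Algebra.algebraMap_self_apply]
      ext i
      simp
    obtain ⟨C, hC0, hTC⟩ := exists_mul_eq_zero_of_mulVec_eq_zero b T hv hTv
    refine ⟨b.repr C, ?_, ?_⟩
    · intro h
      apply hC0
      have : (b.repr C : ι →₀ 𝕜) = 0 := by
        ext i
        simpa using congrFun h i
      simpa using this
    · have hXC : X * C = μ • C := by
        have h1 : T * C = X * C - μ • C := by
          rw [hT, sub_mul, Algebra.algebraMap_eq_smul_one, smul_mul_assoc, one_mul]
        rw [h1] at hTC
        exact (sub_eq_zero.mp hTC)
      rw [regularRep_apply, Algebra.leftMulMatrix_mulVec_repr, hXC, map_smul]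
      rfl
  · rintro ⟨c, hc, hLc⟩
    -- `c` is the coordinate vector of `C := Σ cⱼ Dⱼ ∈ 𝒜`, and `X C = μ C`
    set C : 𝒜 := b.equivFun.symm c with hC
    have hcC : (b.repr C : ι → 𝕜) = c := by
      ext i
      simp [hC, Module.Basis.equivFun_symm_apply]
      rw [Finset.sum_eq_single i]
      · simp
      · intro j _ hji
        simp [Finsupp.single_eq_of_ne (Ne.symm hji)]
      · simp
    have hC0 : C ≠ 0 := by
      intro h
      apply hc
      rw [← hcC, h, map_zero]
      rfl
    have hXC : b.repr (X * C) = b.repr (μ • C) := by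
      have h1 := Algebra.leftMulMatrix_mulVec_repr b X C
      rw [hcC, ← regularRep_apply hb, hLc] at h1
      ext i
      have := congrFun h1 i
      rw [map_smul]
      simpa [hcC] using this.symm
    have hXC' : (X : Matrix n n 𝕜) * (C : Matrix n n 𝕜) = μ • (C : Matrix n n 𝕜) := by
      have h := b.repr.injective hXC
      have := congrArg (fun Z : 𝒜 => (Z : Matrix n n 𝕜)) h
      simpa using this
    -- a non-zero column of `C`
    have hCne : (C : Matrix n n 𝕜) ≠ 0 := by
      intro h
      apply hC0
      exact Subtype.ext h
    obtain ⟨i₀, j₀, hij⟩ : ∃ i j, (C : Matrix n n 𝕜) i j ≠ 0 := by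
      by_contra hall
      push Not at hall
      exact hCne (Matrix.ext fun i j => by simpa using hall i j)
    refine ⟨fun i => (C : Matrix n n 𝕜) i j₀, ?_, ?_⟩
    · intro h
      exact hij (by simpa using congrFun h i₀)
    · ext i
      have := congrFun (congrFun hXC' i) j₀
      simpa [Matrix.mulVec, dotProduct, Matrix.mul_apply] using this


/-! ### Existence of a trace-orthonormal basis

[dKDP, §5] *assume* an orthogonal basis and normalise it in the Frobenius norm; such a basis
always exists (Gram–Schmidt for the positive definite form `tr(Yᴴ Z)`), which we record by
vectorising `𝕜^{n×n}` into the Euclidean space `𝕜^{n·n}` and pulling back an orthonormal basis of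
the image of `𝒜`.  Consequently every matrix `*`-algebra HAS a regular `*`-representation
`regularRep b hb` of size `d = dim 𝒜`. -/

section Existence

omit [DecidableEq n] in
/-- Vectorisation `𝕜^{n×n} → 𝕜^{n·n}` (row-major listing of the entries) into Euclidean space;
under it the Frobenius form `tr(Xᴴ Y)` becomes the standard inner product (`inner_vecE`).
[cite: DeklerkDobrePasechnik2011, §5 (Frobenius norm on 𝒜)] -/
noncomputable def vecE : Matrix n n 𝕜 →ₗ[𝕜] EuclideanSpace 𝕜 (n × n) where
  toFun X := WithLp.toLp 2 (fun p : n × n => X p.1 p.2)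
  map_add' X Y := by
    ext p
    simp
  map_smul' c X := by
    ext p
    simp

omit [Fintype n] [DecidableEq n] in
/-- Entries of the vectorisation. [cite: DeklerkDobrePasechnik2011, §5 (Frobenius norm on 𝒜)] -/
@[simp] theorem vecE_apply (X : Matrix n n 𝕜) (p : n × n) : vecE X p = X p.1 p.2 := rfl

omit [Fintype n] [DecidableEq n] in
/-- Vectorisation is injective. [cite: DeklerkDobrePasechnik2011, §5 (Frobenius norm on 𝒜)] -/
theorem vecE_injective : Function.Injective (vecE (𝕜 := 𝕜) (n := n)) := by
  intro X Y h
  ext i j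
  simpa using congrArg (fun v => v (i, j)) h

omit [DecidableEq n] in
/-- The Euclidean inner product of two vectorised matrices is the trace (Frobenius) form:
`⟪vec X, vec Y⟫ = Σᵢⱼ conj(Xᵢⱼ) Yᵢⱼ = tr(Xᴴ Y)`.
[cite: DeklerkDobrePasechnik2011, §5 (Frobenius norm tr(Bᵢᵀ Bᵢ))] -/
theorem inner_vecE (X Y : Matrix n n 𝕜) : ⟪vecE X, vecE Y⟫_𝕜 = (Xᴴ * Y).trace := by
  rw [PiLp.inner_apply, Matrix.trace]
  simp only [vecE_apply, Matrix.diag_apply, Matrix.mul_apply, Matrix.conjTranspose_apply,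
    RCLike.inner_apply']
  rw [Fintype.sum_prod_type, Finset.sum_comm]
  rfl

/-- **Every matrix `*`-algebra has a trace-orthonormal basis** `D₁, …, D_d`, `d = dim 𝒜`
(the standing assumption "assume now that `𝒜` has an orthogonal basis … normalised with respect
to the Frobenius norm" of [dKDP, §5] is always met over `𝕜 = ℝ, ℂ`): an orthonormal basis of
the image of `𝒜` in the Euclidean space `𝕜^{n·n}` pulled back along the vectorisation.  Hence
`regularRep b hb : 𝒜 →⋆ₐ[𝕜] 𝕜^{d×d}` exists for every `𝒜`.
[cite: DeklerkDobrePasechnik2011, §5 (orthogonal basis normalised in the Frobenius norm)] -/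
theorem exists_isTraceOrthonormal (𝒜 : StarSubalgebra 𝕜 (Matrix n n 𝕜)) :
    ∃ b : Module.Basis (Fin (Module.finrank 𝕜 𝒜)) 𝕜 𝒜, IsTraceOrthonormal 𝒜 b := by
  classical
  let f : 𝒜 →ₗ[𝕜] EuclideanSpace 𝕜 (n × n) := vecE ∘ₗ 𝒜.toSubalgebra.val.toLinearMap
  have hf : Function.Injective f := by
    intro X Y h
    apply Subtype.ext
    exact vecE_injective (by simpa [f] using h)
  let W : Submodule 𝕜 (EuclideanSpace 𝕜 (n × n)) := LinearMap.range f
  let e : 𝒜 ≃ₗ[𝕜] W := LinearEquiv.ofInjective f hf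
  let ob : OrthonormalBasis (Fin (Module.finrank 𝕜 W)) 𝕜 W := stdOrthonormalBasis 𝕜 W
  have hrank : Module.finrank 𝕜 W = Module.finrank 𝕜 𝒜 := e.finrank_eq.symm
  let b : Module.Basis (Fin (Module.finrank 𝕜 𝒜)) 𝕜 𝒜 :=
    (ob.toBasis.map e.symm).reindex (finCongr hrank)
  refine ⟨b, fun i j => ?_⟩
  have hb : ∀ k, ((b k : 𝒜) : Matrix n n 𝕜) = (e.symm (ob ((finCongr hrank).symm k)) : 𝒜) := by
    intro k
    simp [b]
  have hfe : ∀ w : W, f (e.symm w) = (w : EuclideanSpace 𝕜 (n × n)) := by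
    intro w
    have := LinearEquiv.ofInjective_apply f (h := hf) (e.symm w)
    rw [LinearEquiv.apply_symm_apply] at this
    exact this.symm
  have hfv : ∀ Z : 𝒜, f Z = vecE (Z : Matrix n n 𝕜) := fun Z => rfl
  rw [hb i, hb j, ← inner_vecE, ← hfv, ← hfv, hfe, hfe, ← Submodule.coe_inner,
    orthonormal_iff_ite.mp ob.orthonormal]
  simp

/-- **PSD transfer, unconditional form:** for every matrix `*`-algebra `𝒜` there is a faithful
unital `*`-representation `φ : 𝒜 →⋆ₐ[𝕜] 𝕜^{d×d}`, `d = dim 𝒜` (the regular one in a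
trace-orthonormal basis), with `φ X ⪰ 0 ↔ X ⪰ 0` for all `X ∈ 𝒜` — the size reduction
`n × n ↦ d × d` of [dKDP, (7)] / [dKPS] is always available.
[cite: DeklerkDobrePasechnik2011, §5 Thm 2 and eq. (7)] -/
theorem exists_faithful_starAlgHom_posSemidef_iff (𝒜 : StarSubalgebra 𝕜 (Matrix n n 𝕜)) :
    ∃ φ : 𝒜 →⋆ₐ[𝕜] Matrix (Fin (Module.finrank 𝕜 𝒜)) (Fin (Module.finrank 𝕜 𝒜)) 𝕜,
      Function.Injective φ ∧ ∀ X : 𝒜, (φ X).PosSemidef ↔ (X : Matrix n n 𝕜).PosSemidef := by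
  classical
  obtain ⟨b, hb⟩ := exists_isTraceOrthonormal 𝒜
  exact ⟨regularRep b hb, regularRep_injective hb, posSemidef_regularRep_iff hb⟩

end Existence

end Literature.Analysis.Convex.RegularStarRepresentation
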